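import Literature.NumberTheory.Transcendental.KZGroundingRelations
import Literature.NumberTheory.Transcendental.SemialgebraicAlgebraicPoints

/-!
# `CubeNashNormalForm` (stmt-KontsevichZagierPeriods-3574), `k ≤ 1`: bounded plane volumes
# reduce to one-dimensional representations on algebraic intervals

Support file for the item `CubeNashNormalForm` of route `LiftingCriteria`. Let `N ≤ FormalRep`
contain the relations. If every one-dimensional representation whose domain is an open interval
with real algebraic end-points lies in `N`, then so does every BOUNDED plane volume `K = ∫_S 1`,
`S ⊆ ℝ²` (`of_mem_of_volume_two`): cut `S` along the cylinders over the cells of an adapted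
cylindrical decomposition of the line (rule 1); over a cell of measure zero the piece is null; over a
cell `C` of positive length every band of `S` is inner (finite volume), `[S ∩ (C × ℝ)]` is the sum of
its open bands (rule 1), each open band is its closure up to two null graphs, and Newton–Leibniz
(rule 3) takes the closed band down to `∫_C (ξ_j - ξ_{j-1})` (`of_mem_of_forall_base_mem`, any
dimension); finally a cell of positive length carrying a band of the bounded set `S` is a bounded
band of the level-one decomposition, i.e. an open interval whose end-points — values of
`ℚ`-semialgebraic functions at the point `ℝ⁰` — are real algebraic
(`exists_eq_Ioo_of_isCylindricalDecomposition_one`).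
[Kontsevich–Zagier 2001, §1.2 rules (1), (3); Basu–Pollack–Roy 2006, Def. 5.1, Cor. 5.7]
-/

noncomputable section

open Set MeasureTheory Filter Topology
open scoped ENNReal
open Literature.ModelTheory.ExponentialFields
open Literature.NumberTheory.Transcendental
open Literature.NumberTheory.Transcendental.KZ

namespace Summit.KontsevichZagierPeriods.LiftingCriteria.CubeNashNormalFormVolumeTwo

/-- **Down one inner band, membership form** (Steps 1–2 of `KZ.of_sub_of_mem_relations_cell`).
Let `S` be `ℚ`-semialgebraic of finite volume, `C` a `ℚ`-semialgebraic cell with `ℚ`-semialgebraic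
increasing sections `ξ` over which the fibres of `S` are the graphs `j ∈ G` and the bands `j ∈ B`,
and `r = ∫_{S ∩ (C × ℝ)} 1`. If `N ≥ relations` contains every representation with domain `C`
(only needed when `vol C ≠ 0` and some band occurs), then `[r] ∈ N`:
`[r] ≡ ∑_{j ∈ B} [open band_j] ≡ ∑_j [closed band_j] ≡ ∑_j [C, ξ_j − ξ_{j-1}]` by rules (1), (3).
[cite: KontsevichZagier2001, §1.2 rules (1),(3)] -/
theorem of_mem_of_forall_base_mem {m l : ℕ} {S : Set (Fin (m + 1) → ℝ)} (hS : IsSemialgebraic ℚ S)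
    (hfin : volume S ≠ ⊤) {C : Set (Fin m → ℝ)} (hC : IsSemialgebraic ℚ C)
    (ξ : Fin l → (Fin m → ℝ) → ℝ) (hξ : ∀ i, IsSemialgebraicFunOn ℚ C (ξ i))
    (hmono : ∀ x ∈ C, StrictMono fun i => ξ i x) (G : Finset (Fin l)) (B : Finset (Fin (l + 1)))
    (hBsub : ∀ j ∈ B, bandOver C ξ j ⊆ S) (hBsa : ∀ j, IsSemialgebraic ℚ (bandOver C ξ j))
    (hfib : ∀ x ∈ C, {t : ℝ | (Fin.snoc x t : Fin (m + 1) → ℝ) ∈ S} = (⋃ j ∈ G, {ξ j x}) ∪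
      ⋃ j ∈ B, {t : ℝ | bandLower ξ j x < (t : EReal) ∧ (t : EReal) < bandUpper ξ j x})
    (r : IntegralRep (m + 1)) (hrd : r.domain = S ∩ {z | Fin.init z ∈ C})
    (hr1 : ∀ x ∈ r.domain, r.integrand x = 1) (N : AddSubgroup FormalRep) (hrel : relations ≤ N)
    (hbase : B.Nonempty → volume C ≠ 0 → ∀ b : IntegralRep m, b.domain = C → of b ∈ N) :
    of r ∈ N := by
  classical
  have hSm : MeasurableSet S := IsSemialgebraic.measurableSet_holds hS
  have hCm : MeasurableSet C := IsSemialgebraic.measurableSet_holds hC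
  by_cases hC0 : volume C = 0
  · refine hrel (of_mem_relations_of_volume_eq_zero r ?_)
    rw [hrd]
    exact measure_mono_null inter_subset_right (volume_setOf_init_mem_eq_zero (n := m) hC0)
  -- all bands over `C` are inner
  have hinner : ∀ j ∈ B, j ≠ 0 ∧ j ≠ Fin.last l := fun j hj =>
    ne_zero_and_ne_last_of_bandOver_subset hSm hfin hCm hC0 ξ (hBsub j hj)
  -- Step 1: cut `S ∩ (C × ℝ)` into its open bands
  have hOb : ∀ j : {j // j ∈ B}, ∃ Ob : IntegralRep (m + 1),
      Ob.domain = bandOver C ξ j ∧ Ob.integrand = fun _ => 1 := fun j =>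
    exists_oneRep (hBsa j) ((measure_mono (hBsub j j.2)).trans_lt hfin.lt_top).ne
  choose Ob hObd hObi using hOb
  have e1 : of r - ∑ j ∈ B.attach, of (Ob j) ∈ relations := by
    refine of_sub_sum_of_mem_relations B.attach r Ob (fun j _ => ?_) (fun j _ x hx => ?_) ?_ ?_
    · rw [hObd, hrd, show bandOver C ξ j \ (S ∩ {z | Fin.init z ∈ C}) = ∅ from
        sdiff_eq_empty.mpr fun z hz => ⟨hBsub j j.2 hz, (mem_bandOver_iff.1 hz).1⟩, measure_empty]
    · rw [hObi, hr1 x hx.2]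
    · have hsub : r.domain \ ⋃ j ∈ B.attach, (Ob j).domain ⊆
          ⋃ j ∈ G, {z : Fin (m + 1) → ℝ | Fin.init z ∈ C ∧ z (Fin.last m) = ξ j (Fin.init z)} := by
        intro z hz
        rw [hrd] at hz
        obtain ⟨⟨hzS, hzC⟩, hzU⟩ := hz
        have hzC : Fin.init z ∈ C := hzC
        have ht : z (Fin.last m) ∈ {t : ℝ | (Fin.snoc (Fin.init z) t : Fin (m + 1) → ℝ) ∈ S} := by
          show Fin.snoc (Fin.init z) (z (Fin.last m)) ∈ S
          rw [Fin.snoc_init_self]; exact hzS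
        rw [hfib _ hzC] at ht
        rcases ht with ht | ht
        · simp only [mem_iUnion, mem_singleton_iff, exists_prop] at ht
          obtain ⟨j, hj, hjt⟩ := ht
          exact mem_iUnion₂.2 ⟨j, hj, hzC, hjt⟩
        · simp only [mem_iUnion, mem_setOf_eq, exists_prop] at ht
          obtain ⟨j, hj, hjt⟩ := ht
          exact absurd (mem_iUnion₂.2 ⟨⟨j, hj⟩, Finset.mem_attach _ _, by
            rw [hObd]; exact ⟨hzC, hjt.1, hjt.2⟩⟩) hzU
      refine measure_mono_null hsub ((measure_biUnion_null_iff G.countable_toSet).2 fun j _ => ?_)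
      exact volume_graph_eq_zero (hξ j)
    · intro j _ j' _ hne
      have hne' : (j : Fin (l + 1)) ≠ j' := fun h => hne (Subtype.ext h)
      have : (Ob j).domain ∩ (Ob j').domain = ∅ := by
        rw [hObd, hObd]
        ext z
        simp only [mem_inter_iff, mem_empty_iff_false, iff_false, not_and]
        intro hz hz'
        rw [mem_bandOver_iff] at hz hz'
        exact (Set.disjoint_left.1 (disjoint_bandFibre ξ (hmono _ hz.1) hne')) ⟨hz.2.1, hz.2.2⟩
          ⟨hz'.2.1, hz'.2.2⟩
      rw [this, measure_empty]
  -- Step 2: close the bands (null modification) and go down by Newton–Leibniz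
  have hBb : ∀ j : {j // j ∈ B}, ∃ (Bd : IntegralRep (m + 1)) (b : IntegralRep m),
      Bd.domain = KZlog.band C (fun x => (bandLower ξ j x).toReal) (fun x => (bandUpper ξ j x).toReal) ∧
      (Bd.integrand = fun _ => 1) ∧ b.domain = C ∧
      (b.integrand = fun x => (bandUpper ξ j x).toReal - (bandLower ξ j x).toReal) ∧
      of Bd - of b ∈ newtonLeibnizRel := fun j =>
    exists_band_sub_base_mem_newtonLeibnizRel hfin hC ξ hξ hmono (hinner j j.2).1 (hinner j j.2).2
      (hBsub j j.2)
  choose Bd b hBdd hBdi hbd _hbi hNL using hBb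
  have e2 : ∀ j : {j // j ∈ B}, of (Ob j) - of (Bd j) ∈ relations := by
    intro j
    have h0 := (hinner j j.2).1
    have hl := (hinner j j.2).2
    refine of_sub_of_mem_relations_of_null (Ob j) (Bd j) ?_ ?_ fun z _ => by rw [hObi, hBdi]
    · rw [hObd, hBdd, show bandOver C ξ j \ KZlog.band C (fun x => (bandLower ξ j x).toReal)
          (fun x => (bandUpper ξ j x).toReal) = ∅ from sdiff_eq_empty.mpr fun z hz => ?_, measure_empty]
      rw [mem_bandOver_iff, bandLower_of_ne_zero ξ j h0, bandUpper_of_ne_last ξ j hl,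
        EReal.coe_lt_coe_iff, EReal.coe_lt_coe_iff] at hz
      rw [KZlog.mem_band, bandLower_of_ne_zero ξ j h0, bandUpper_of_ne_last ξ j hl, EReal.toReal_coe,
        EReal.toReal_coe]
      exact ⟨hz.1, hz.2.1.le, hz.2.2.le⟩
    · have hlosa : IsSemialgebraicFunOn ℚ C fun x => (bandLower ξ j x).toReal :=
        (hξ (Fin.pred j h0)).congr fun x _ => by rw [bandLower_of_ne_zero ξ j h0, EReal.toReal_coe]
      have hhisa : IsSemialgebraicFunOn ℚ C fun x => (bandUpper ξ j x).toReal :=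
        (hξ (Fin.castPred j hl)).congr fun x _ => by rw [bandUpper_of_ne_last ξ j hl, EReal.toReal_coe]
      refine measure_mono_null (fun z hz => ?_)
        (measure_union_null (volume_graph_eq_zero hlosa) (volume_graph_eq_zero hhisa))
      rw [hBdd, hObd] at hz
      obtain ⟨hz, hz'⟩ := hz
      rw [KZlog.mem_band] at hz
      obtain ⟨hzC, h1, h2⟩ := hz
      rcases h1.lt_or_eq with h1 | h1
      · rcases h2.lt_or_eq with h2 | h2
        · refine absurd (mem_bandOver_iff.2 ⟨hzC, ?_, ?_⟩) hz'
          · rw [bandLower_of_ne_zero ξ j h0, EReal.coe_lt_coe_iff]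
            rwa [bandLower_of_ne_zero ξ j h0, EReal.toReal_coe] at h1
          · rw [bandUpper_of_ne_last ξ j hl, EReal.coe_lt_coe_iff]
            rwa [bandUpper_of_ne_last ξ j hl, EReal.toReal_coe] at h2
        · exact Or.inr ⟨hzC, h2⟩
      · exact Or.inl ⟨hzC, h1.symm⟩
  -- assembly
  have e2' : ∑ j ∈ B.attach, of (Ob j) - ∑ j ∈ B.attach, of (Bd j) ∈ relations :=
    sum_sub_sum_mem_relations _ _ _ fun j _ => e2 j
  have eNL : ∑ j ∈ B.attach, of (Bd j) - ∑ j ∈ B.attach, of (b j) ∈ relations :=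
    sum_sub_sum_mem_relations _ _ _ fun j _ => newtonLeibnizRel_subset_relations (hNL j)
  have hbN : ∑ j ∈ B.attach, of (b j) ∈ N :=
    N.sum_mem fun j _ => hbase ⟨j, j.2⟩ hC0 (b j) (hbd j)
  have : of r = (of r - ∑ j ∈ B.attach, of (Ob j)) +
      (∑ j ∈ B.attach, of (Ob j) - ∑ j ∈ B.attach, of (Bd j)) +
      (∑ j ∈ B.attach, of (Bd j) - ∑ j ∈ B.attach, of (b j)) + ∑ j ∈ B.attach, of (b j) := by abel
  rw [this]
  exact N.add_mem (N.add_mem (N.add_mem (hrel e1) (hrel e2')) (hrel eNL)) hbN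

/-- **Cells of a cylindrical decomposition of the line.** A cell of a `ℚ`-cylindrical
decomposition of `ℝ¹` which has positive length and is bounded is an open interval `(c, c')` with
real algebraic end-points: the cells are the graphs (points, null) and the bands over the point `ℝ⁰`;
the two extreme bands are unbounded, and the end-points of an inner band are values of
`ℚ`-semialgebraic functions at the (algebraic) point `ℝ⁰`. [cite: BasuPollackRoy2006, Def. 5.1] -/
theorem exists_eq_Ioo_of_isCylindricalDecomposition_one {𝒮 : Finset (Set (Fin 1 → ℝ))}
    (hcd : IsCylindricalDecomposition ℚ 1 𝒮) {C : Set (Fin 1 → ℝ)} (hC : C ∈ 𝒮)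
    (hC0 : volume C ≠ 0) (hbd : ∃ R : ℝ, ∀ x ∈ C, |x 0| ≤ R) :
    ∃ c c' : ℝ, c < c' ∧ IsAlgebraic ℚ c ∧ IsAlgebraic ℚ c' ∧
      C = {z : Fin 1 → ℝ | z 0 ∈ Ioo c c'} := by
  obtain ⟨-, -, 𝒮₀, h𝒮₀, l, ζ, -, hζs, hζm, hmem⟩ := hcd
  have h0 : 𝒮₀ = {univ} := isCylindricalDecomposition_zero.1 h𝒮₀
  obtain ⟨S, hS, hT⟩ := (hmem C).1 hC
  have hSu : S = univ := by rw [h0, Finset.mem_singleton] at hS; exact hS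
  subst hSu
  obtain ⟨R, hR⟩ := hbd
  let p : Fin 0 → ℝ := fun i => i.elim0
  have hinit : ∀ z : Fin 1 → ℝ, Fin.init z = p := fun z => Subsingleton.elim _ _
  rcases hT with ⟨j, rfl⟩ | ⟨j, rfl⟩
  · exact absurd (volume_graph_eq_zero (hζs univ hS j)) hC0
  · by_cases hj0 : j = 0
    · -- the lowest band is unbounded below
      subst hj0
      obtain ⟨t, ht⟩ := exists_coe_lt_bandUpper (ζ univ) 0 p
      have hz : (fun _ => min t (-R - 1) : Fin 1 → ℝ) ∈ bandOver univ (ζ univ) 0 := by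
        rw [mem_bandOver_iff, hinit, bandLower_zero]
        exact ⟨mem_univ _, EReal.bot_lt_coe _, lt_of_le_of_lt (EReal.coe_le_coe_iff.2
          (min_le_left _ _)) ht⟩
      have h1 := hR _ hz
      have h2 : min t (-R - 1) ≤ -R - 1 := min_le_right _ _
      exact absurd (abs_le.1 h1).1 (by linarith)
    by_cases hjl : j = Fin.last (l univ)
    · -- the highest band is unbounded above
      subst hjl
      obtain ⟨t, ht⟩ := exists_bandLower_lt_coe (ζ univ) (Fin.last (l univ)) p
      have hz : (fun _ => max t (R + 1) : Fin 1 → ℝ) ∈ bandOver univ (ζ univ) (Fin.last (l univ)) := by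
        rw [mem_bandOver_iff, hinit, bandUpper_last]
        exact ⟨mem_univ _, lt_of_lt_of_le ht (EReal.coe_le_coe_iff.2 (le_max_left _ _)),
          EReal.coe_lt_top _⟩
      have h1 := hR _ hz
      have h2 : R + 1 ≤ max t (R + 1) := le_max_right _ _
      exact absurd (abs_le.1 h1).2 (by linarith)
    -- an inner band
    refine ⟨ζ univ (j.pred hj0) p, ζ univ (j.castPred hjl) p, ?_, ?_, ?_, ?_⟩
    · refine hζm univ hS p (mem_univ _) ?_
      rw [Fin.lt_def, Fin.val_pred, Fin.coe_castPred]
      exact Nat.sub_one_lt fun h => hj0 (Fin.ext h)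
    · exact (hζs univ hS _).isAlgebraic_apply (mem_univ _) fun i => i.elim0
    · exact (hζs univ hS _).isAlgebraic_apply (mem_univ _) fun i => i.elim0
    · ext z
      rw [mem_bandOver_iff, bandLower_of_ne_zero _ j hj0, bandUpper_of_ne_last _ j hjl,
        EReal.coe_lt_coe_iff, EReal.coe_lt_coe_iff, hinit]
      simp only [mem_univ, true_and, mem_setOf_eq, mem_Ioo]
      rfl

/-- **Bounded plane volumes reduce to one-dimensional representations on algebraic intervals.**
See the module docstring. [cite: KontsevichZagier2001, §1.2 rules (1),(3)] -/
theorem of_mem_of_volume_two (N : AddSubgroup FormalRep) (hrel : relations ≤ N)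
    (h1d : ∀ (b : IntegralRep 1) (c c' : ℝ), c < c' → IsAlgebraic ℚ c → IsAlgebraic ℚ c' →
      b.domain = {z : Fin 1 → ℝ | z 0 ∈ Ioo c c'} → of b ∈ N)
    (K : IntegralRep (1 + 1)) (hK1 : ∀ x ∈ K.domain, K.integrand x = 1)
    (hKb : Bornology.IsBounded K.domain) : of K ∈ N := by
  classical
  have hS : IsSemialgebraic ℚ K.domain := K.isSemialgebraic_domain
  have hfin : volume K.domain ≠ ⊤ := volume_ne_top_of_integrand_one K hK1
  obtain ⟨𝒮, l, ξ, hcd, -, hξ, hmono, hcells, hfib⟩ :=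
    IsSemialgebraic.exists_cylindricalDecomposition.exists_fibre_eq
      (IsSemialgebraic.exists_cylindricalDecomposition_holds (k := ℚ)) hS
  have hpart := hcd.isPartition
  have h𝒮sa := hcd.isSemialgebraic
  -- the pieces of `K` over the cells
  let R : {C // C ∈ 𝒮} → IntegralRep (1 + 1) := fun C =>
    K.restrict (K.domain ∩ {z | Fin.init z ∈ (C : Set (Fin 1 → ℝ))})
      (hS.inter (h𝒮sa C C.2).setOf_init_mem) inter_subset_left
  have eR : of K - ∑ C ∈ 𝒮.attach, of (R C) ∈ relations :=
    of_sub_sum_cyl_mem_relations K 𝒮 hpart R (fun C => rfl) fun C x _ => rfl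
  obtain ⟨Rad, hRad⟩ := hKb.subset_closedBall 0
  have hcell : ∀ C : {C // C ∈ 𝒮}, of (R C) ∈ N := by
    intro C
    obtain ⟨G, B, -, hBsub, hfibC⟩ := hfib C C.2
    refine of_mem_of_forall_base_mem hS hfin (h𝒮sa C C.2) (ξ C) (hξ C C.2) (hmono C C.2) G B
      hBsub (hcells C C.2).2 hfibC (R C) rfl (fun x hx => hK1 x hx.1) N hrel fun hB hC0 b hbd => ?_
    obtain ⟨j, hj⟩ := hB
    -- a cell carrying a band of the bounded set `K.domain` is bounded
    have hbdC : ∃ R : ℝ, ∀ x ∈ (C : Set (Fin 1 → ℝ)), |x 0| ≤ R := by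
      refine ⟨Rad, fun x hx => ?_⟩
      obtain ⟨t, ht1, ht2⟩ := CylindricalDecomposition.exists_mem_band (ξ C) x (hmono C C.2 x hx) j
      have hz : (Fin.snoc x t : Fin (1 + 1) → ℝ) ∈ K.domain :=
        hBsub j hj (snoc_mem_bandOver_iff.2 ⟨hx, ht1, ht2⟩)
      have hzR := hRad hz
      rw [Metric.mem_closedBall, dist_zero_right] at hzR
      have hx0 : (Fin.snoc x t : Fin (1 + 1) → ℝ) (Fin.castSucc 0) = x 0 := Fin.snoc_castSucc ..
      calc |x 0| = ‖(Fin.snoc x t : Fin (1 + 1) → ℝ) (Fin.castSucc 0)‖ := by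
            rw [hx0, Real.norm_eq_abs]
        _ ≤ ‖(Fin.snoc x t : Fin (1 + 1) → ℝ)‖ := norm_le_pi_norm _ _
        _ ≤ Rad := hzR
    obtain ⟨c, c', hcc', hc, hc', hCeq⟩ :=
      exists_eq_Ioo_of_isCylindricalDecomposition_one hcd C.2 hC0 hbdC
    exact h1d b c c' hcc' hc hc' (hbd.trans hCeq)
  have : of K = (of K - ∑ C ∈ 𝒮.attach, of (R C)) + ∑ C ∈ 𝒮.attach, of (R C) := by abel
  rw [this]
  exact N.add_mem (hrel eR) (N.sum_mem fun C _ => hcell C)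

end Summit.KontsevichZagierPeriods.LiftingCriteria.CubeNashNormalFormVolumeTwo
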